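import Literature.Geometry.Riemannian.VolumeScaling
import HarnessLib

/-!
# Local curvature bounds and `κ`-noncollapsing under constant rescaling
(topic `Geometry/Riemannian`)

Companion to `RicciFlowMaximalScaling.lean` (`curvatureBoundedBy_constSmul_iff`, the global frame
bound) and `VolumeScaling.lean`: the local frame-wise curvature bound `CurvatureBoundedOn` and the
parabolic `κ`-noncollapsing property `IsKappaNoncollapsed` of `CanonicalNeighbourhoods.lean`
(Perelman 2002, Def. 4.2, in the parabolic form of Chen–Zhu 2006, §3, p. 7) are scale-covariant:
* `curvatureBoundedOn_constSmul_iff`: the curvature of `(c h, ∇)` is bounded by `C` on `U` (on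
  `c h`-unit vectors) iff that of `(h, ∇)` is bounded by `c C` (Topping 2006, §1.2.3,
  `|Rm| ↦ λ⁻¹ |Rm|`);
* `IsKappaNoncollapsed.parabolicRescale`: if the flow `g` on `[0, T)` is `κ`-noncollapsed for
  scale `r₀`, the rescaled flow `τ ↦ a g(τ/a)` on `[0, a T)` is `κ`-noncollapsed for scale
  `√a r₀` — with the SAME `κ` (Perelman 2002, §4: "`κ`-noncollapsing is invariant under
  scaling"; this is why `κ` survives the blow-up arguments of Chen–Zhu 2006, §§3–5).

## References

* G. Perelman, *The entropy formula for the Ricci flow and its geometric applications*,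
  arXiv:math/0211159, §4, Def. 4.2. [Perelman2002]
* B.-L. Chen, X.-P. Zhu, arXiv:math/0504478, §3, p. 7. [ChenZhu2006]
* P. Topping, *Lectures on the Ricci flow* (2006), §1.2.3. [Topping2006]
-/

noncomputable section

open Bundle Set Filter MeasureTheory
open scoped Manifold ContDiff Topology ENNReal

namespace Literature.Geometry.Riemannian

open Literature.Geometry.Lorentzian (PseudoRiemannianMetric)
open Literature.Geometry.Lorentzian.PseudoRiemannianMetric

variable {E : Type*} [NormedAddCommGroup E] [NormedSpace ℝ E] [FiniteDimensional ℝ E]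
  {H : Type*} [TopologicalSpace H] {I : ModelWithCorners ℝ E H} {M : Type*} [TopologicalSpace M]
  [ChartedSpace H M] [IsManifold I ∞ M] {n : ℕ∞ω}

omit [FiniteDimensional ℝ E] in
/-- **Local curvature bounds under homothety**: for `c > 0` the curvature of `(c • h, ∇)` is
bounded by `C` on `U` (on `c • h`-unit vectors) iff the curvature of `(h, ∇)` is bounded by `c C`
on `U` (on `h`-unit vectors) — the local form of `curvatureBoundedBy_constSmul_iff`, same proof
(substitute `X ↦ c^{∓1/2} X`; `Rm_{c h} = c Rm_h`, degree-4 homogeneity of `Rm`).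
[cite: Topping2006, §1.2.3] -/
theorem curvatureBoundedOn_constSmul_iff
    (h : PseudoRiemannianMetric I n E (TangentSpace I : M → Type _))
    (cov₀ : CovariantDerivative I E (TangentSpace I : M → Type _)) {c : ℝ} (hc : 0 < c)
    (U : Set M) (C : ℝ) :
    CurvatureBoundedOn (h.constSmul c hc.ne') cov₀ U C ↔ CurvatureBoundedOn h cov₀ U (c * C) := by
  have hsq : Real.sqrt c ^ 2 = c := Real.sq_sqrt hc.le
  have h4 : Real.sqrt c ^ 4 = c ^ 2 := by
    calc Real.sqrt c ^ 4 = (Real.sqrt c ^ 2) ^ 2 := by ring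
      _ = c ^ 2 := by rw [hsq]
  have h4' : (Real.sqrt c)⁻¹ ^ 4 = (c ^ 2)⁻¹ := by rw [inv_pow, h4]
  have hunit : ∀ (x : M) (a : ℝ) (X : TangentSpace I x),
      h.val x (a • X) (a • X) = a ^ 2 * h.val x X X := by
    intro x a X
    simp only [map_smul, smul_apply, smul_eq_mul]
    ring
  constructor
  · intro hb x hx X Y Z W hX hY hZ hW
    set a : ℝ := (Real.sqrt c)⁻¹ with ha
    have ha2 : c * a ^ 2 = 1 := by
      rw [ha, inv_pow, hsq, mul_inv_cancel₀ hc.ne']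
    have hu : ∀ V : TangentSpace I x, h.val x V V ≤ 1 →
        (h.constSmul c hc.ne').val x (a • V) (a • V) ≤ 1 := by
      intro V hV
      rw [constSmul_apply, hunit, ← mul_assoc, ha2, one_mul]
      exact hV
    have key := hb x hx (a • X) (a • Y) (a • Z) (a • W) (hu X hX) (hu Y hY) (hu Z hZ) (hu W hW)
    rw [curvatureForm_constSmul, curvatureForm_smul_smul_smul_smul, ha, h4'] at key
    have hc2 : c * (c ^ 2)⁻¹ = c⁻¹ := by field_simp
    rw [← mul_assoc, hc2, abs_mul, abs_inv, abs_of_pos hc] at key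
    rwa [inv_mul_le_iff₀ hc] at key
  · intro hb x hx X Y Z W hX hY hZ hW
    set a : ℝ := Real.sqrt c with ha
    have hu : ∀ V : TangentSpace I x, (h.constSmul c hc.ne').val x V V ≤ 1 →
        h.val x (a • V) (a • V) ≤ 1 := by
      intro V hV
      rw [hunit, ha, hsq]
      rwa [constSmul_apply] at hV
    have key := hb x hx (a • X) (a • Y) (a • Z) (a • W) (hu X hX) (hu Y hY) (hu Z hZ) (hu W hW)
    rw [curvatureForm_smul_smul_smul_smul, ha, h4, abs_mul, abs_of_pos (pow_pos hc 2)] at key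
    rw [curvatureForm_constSmul, abs_mul, abs_of_pos hc]
    have := mul_le_mul_of_nonneg_left key (inv_pos.2 hc).le
    calc c * |h.curvatureForm cov₀ x X Y Z W|
        = c⁻¹ * (c ^ 2 * |h.curvatureForm cov₀ x X Y Z W|) := by field_simp
      _ ≤ c⁻¹ * (c * C) := this
      _ = C := by field_simp

/-- **`κ`-noncollapsing is scale-invariant** (Perelman 2002, §4; Chen–Zhu 2006, §3, p. 7): if the
flow `(g, ∇)` on `[0, T)` is `κ`-noncollapsed for scale `r₀ ≥ 0` (parabolic form
`IsKappaNoncollapsed`), then the parabolically rescaled flow `τ ↦ a g(τ/a)`, `τ ↦ ∇(τ/a)` on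
`[0, a T)` is `κ`-noncollapsed for scale `√a r₀`, with the same `κ`: a parabolic ball of radius
`√a r₀` at `(x₀, τ₀)` for the rescaled flow is the parabolic ball of radius `r₀` at `(x₀, τ₀/a)`
(`ball_constSmul_ofReal`; `(√a r₀)² = a r₀²`), the curvature hypothesis `|Rm| ≤ (√a r₀)⁻²` there is
`|Rm| ≤ r₀⁻²` for `g` (`curvatureBoundedOn_constSmul_iff`), and
`Vol_{a g}(B) = (√a)ⁿ Vol_g(B) ≥ (√a)ⁿ κ r₀ⁿ = κ (√a r₀)ⁿ` (`vol_constSmul`).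
[cite: Perelman2002, §4, Def. 4.2] [cite: ChenZhu2006, §3, p. 7] -/
theorem IsKappaNoncollapsed.parabolicRescale [T3Space M] [MeasurableSpace M] [BorelSpace M]
    {g : ℝ → PseudoRiemannianMetric I ∞ E (TangentSpace I : M → Type _)}
    {cov : ℝ → CovariantDerivative I E (TangentSpace I : M → Type _)} {T κ r₀ a : ℝ}
    (ha : 0 < a) (hr₀ : 0 ≤ r₀) (h : IsKappaNoncollapsed g cov (Ico 0 T) κ r₀) :
    IsKappaNoncollapsed (fun τ ↦ (g (a⁻¹ * τ)).constSmul a ha.ne') (fun τ ↦ cov (a⁻¹ * τ))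
      (Ico 0 (a * T)) κ (Real.sqrt a * r₀) := by
  intro x₀ τ₀ hIcc hcurv
  have hsa : 0 < Real.sqrt a := Real.sqrt_pos.mpr ha
  have hsq : (Real.sqrt a * r₀) ^ 2 = a * r₀ ^ 2 := by rw [mul_pow, Real.sq_sqrt ha.le]
  -- the corresponding parabolic ball for `g` at `(x₀, τ₀/a)`: times `t` with `a t` in the window
  have hat : ∀ t ∈ Icc (a⁻¹ * τ₀ - r₀ ^ 2) (a⁻¹ * τ₀),
      a * t ∈ Icc (τ₀ - (Real.sqrt a * r₀) ^ 2) τ₀ := by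
    intro t ht
    rw [hsq]
    constructor
    · have h1 := mul_le_mul_of_nonneg_left ht.1 ha.le
      rw [mul_sub, mul_inv_cancel_left₀ ha.ne'] at h1
      linarith
    · have h2 := mul_le_mul_of_nonneg_left ht.2 ha.le
      rwa [mul_inv_cancel_left₀ ha.ne'] at h2
  have hIcc' : Icc (a⁻¹ * τ₀ - r₀ ^ 2) (a⁻¹ * τ₀) ⊆ Ico 0 T := by
    intro t ht
    have := hIcc (hat t ht)
    exact ⟨(mul_nonneg_iff_of_pos_left ha).mp this.1, lt_of_mul_lt_mul_left this.2 ha.le⟩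
  have hcurv' : ∀ t ∈ Icc (a⁻¹ * τ₀ - r₀ ^ 2) (a⁻¹ * τ₀),
      CurvatureBoundedOn (g t) (cov t) ((g t).ball x₀ (ENNReal.ofReal r₀)) (r₀⁻¹ ^ 2) := by
    intro t ht
    have key := hcurv (a * t) (hat t ht)
    simp only [inv_mul_cancel_left₀ ha.ne'] at key
    rw [ball_constSmul_ofReal _ ha, curvatureBoundedOn_constSmul_iff _ _ ha] at key
    -- `a (√a r₀)⁻² = r₀⁻²`
    by_cases hr : r₀ = 0
    · subst hr
      simp only [mul_zero, inv_zero, ne_eq, OfNat.ofNat_ne_zero, not_false_eq_true, zero_pow,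
        mul_zero] at key ⊢
      exact key
    · have : a * (Real.sqrt a * r₀)⁻¹ ^ 2 = r₀⁻¹ ^ 2 := by
        rw [inv_pow, hsq, mul_inv, ← mul_assoc, mul_inv_cancel₀ ha.ne', one_mul, inv_pow]
      rwa [this] at key
  have hvol := h x₀ (a⁻¹ * τ₀) hIcc' hcurv'
  -- volumes: `Vol_{a g}(B) = (√a)ⁿ Vol_g(B) ≥ (√a)ⁿ κ r₀ⁿ = κ (√a r₀)ⁿ`
  show ENNReal.ofReal (κ * (Real.sqrt a * r₀) ^ Module.finrank ℝ E) ≤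
    ((g (a⁻¹ * τ₀)).constSmul a ha.ne').vol
      (((g (a⁻¹ * τ₀)).constSmul a ha.ne').ball x₀ (ENNReal.ofReal (Real.sqrt a * r₀)))
  rw [ball_constSmul_ofReal _ ha, vol_constSmul _ ha, mul_pow, mul_left_comm,
    ENNReal.ofReal_mul (pow_nonneg (Real.sqrt_nonneg a) _), ENNReal.ofReal_pow (Real.sqrt_nonneg a)]
  gcongr

end Literature.Geometry.Riemannian

end
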